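import Summits.AtomisticToContinuum.HydrodynamicLimit.Theorems.ImplosionDichotomyDenseExcursionConeLocality
import Summits.AtomisticToContinuum.HydrodynamicLimit.Theorems.ImplosionDichotomyDenseExcursionMemberCoreChart
import Summits.AtomisticToContinuum.HydrodynamicLimit.Theorems.ImplosionDichotomyDenseExcursionMemberCoreKidder
import Summits.AtomisticToContinuum.HydrodynamicLimit.Theorems.ImplosionDichotomyDenseExcursionR2WellPosedness
import Summits.AtomisticToContinuum.HydrodynamicLimit.Theorems.ImplosionDichotomyHsEosLowDensity
import Summits.AtomisticToContinuum.HydrodynamicLimit.Theorems.ImplosionDichotomyPolynomialCompressionSolutionAPI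

/-!
# Exterior agreement on the torus — stub `stub_exteriorAgreement` (line `r2-one-mode-two-conditions`, v8)

Crux `Summit.AtomisticToContinuum.HydrodynamicLimit.Theses.ImplosionDichotomy.DenseExcursion`
(stmt-AtomisticToContinuum-12586), skeleton v8 of the line `r2-one-mode-two-conditions`, registered stub
`stub_exteriorAgreement : ExteriorAgreement` (definition verbatim from the skeleton, §0d).

**Statement.** There is a packing threshold `η₁ > 0` such that two classical hard-sphere Euler solutions on `𝕋³`
(same `σ > 0`) of packing `< η₁` on `[0, t₁)`, whose data agree off the closed chart ball `{x₀ + proj y : ‖y‖ ≤ R₀}`,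
agree at every `(t, x)`, `t < t₁`, with `x` off the fattened ball `{x₀ + proj y : ‖y‖ ≤ R₀ + ct}`, where `c` bounds
`‖u₁‖ + √(2θ₁)` of the FIRST solution only.

**Proof.**
* `η₁` (`exists_packing_threshold`): with `η₀, Z` from `exists_smooth_compressibility_Icc hsEosLowDensity_proof`
  (`Z` smooth, `Z = hsCompressibility` on `[0, η₀]`, `Z 0 = 1`), continuity at `0` of `Z + ηZ′` (value `1`) and of
  `Z + ηZ′ + (2/3)Z²` (value `5/3 < 2`) gives `η₁ ≤ η₀` with `Z + ηZ′ > 0` (hyperbolicity of the rescaled law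
  `ζ(r) = Z(rσ³)`, `ζ + rζ′ = Z + ηZ′` at `η = rσ³`) and `ζ + rζ′ + (2/3)ζ² ≤ 2` (the athermal sound speed
  `c_s² = θ(ζ + rζ′) + (2/3)θζ²` is `≤ 2θ`) at packing in `[0, η₁]`.
* Chart reading (`athermalEulerAt_chart_law`, the `σ > 0` twin of `MemberCoreProof.athermalEulerAt_chart`): a classical
  solution whose pressure is `ρθζ(ρ)` on its horizon, read in the chart `v ↦ x₀ + proj v`, solves `AthermalEulerAt ζ` at
  interior times (primitive form `timeDeriv_density_eq / density_mul_timeDeriv_velocity_eq / timeDeriv_temperature_eq`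
  of `HardSphereEulerPrimitiveForm.lean`, torus operators read in the chart by `MemberCoreProof.torusPartialDeriv_chart`,
  coordinates of vector derivatives by `MemberCoreProof.deriv_apply_coord` & co. of `…MemberCoreKidder.lean`).
* Geometry (`exists_margin`): `x` is off the fattened ball iff EVERY chart preimage `z` of `x` has `‖z‖ > R₀ + ct`; the
  preimages form a closed set, so minimising the norm over its compact trace in `‖z‖ ≤ R₀ + ct + 1` gives a margin
  `m > R₀ + ct` below all of them. For `ε = (m − R₀ − ct)/2` the straight backward cone with vertex `z`, radius
  `ct + ε`, has its base ball inside the data-agreement region: a preimage `y`, `‖y‖ ≤ R₀`, of a base point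
  `x₀ + proj v`, `‖v − z‖ < ct + ε`, would make `z + (y − v)` a preimage of `x` of norm `< m`.
* Agreement (`agree_of_law`): fix `t < τ < t₁` and restrict both solutions to `[0, τ)` (so that the pressure law holds
  on the whole horizon); on the compact slab `[0, τ] × 𝕋³` both densities attain their extrema
  (`exists_forall_le_and_forall_ge`), giving a range `[a, b]`, `a > 0`, `b < η₁σ⁻³`, on which `ζ` is hyperbolic;
  temperatures are positive; the speed hypothesis of the first solution dominates its characteristic speed; the landed
  straight-cone locality `KidderKnobMelnikov.stub_coneLocality : HsEulerConeLocality` on the cone above concludes.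
  (The straight-cone lemma already covers cones of any duration `< τ`, so no continuity induction in time is needed;
  the hypotheses `0 ≤ R₀` and `R₀ + c t₁ < 1/4` of the registered statement are not used.)
-/

noncomputable section

open Set Filter Topology
open scoped ContDiff

namespace Summit.AtomisticToContinuum.HydrodynamicLimit.Theorems.R2OneModeTwoConditions

open Literature.MathematicalPhysics.KineticTheory
open Literature.Analysis.FunctionSpaces
open Literature.Analysis.FluidPDE (IsentropicEuler.clm_apply_eq_sum)
open Summit.AtomisticToContinuum.HydrodynamicLimit.Theorems.KidderKnobMelnikov (AthermalEulerAt HsEulerConeLocality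
  stub_coneLocality HsEulerConeLocality.eq_of_cone)
open Summit.AtomisticToContinuum.HydrodynamicLimit.Theorems.KidderKnobMelnikov.MemberCoreProof (contDiffOn_chart
  torusPartialDeriv_chart deriv_apply_coord fderiv_apply_coord gradient_apply_eq_fderiv)

/-! ## The statement (verbatim: skeleton §0d) -/

/-- EXTERIOR AGREEMENT on the torus (the exterior `C¹` bounds of the continuation argument): there is a packing threshold
`η₁ > 0` such that two classical hard-sphere Euler solutions on `𝕋³` (same `σ > 0`) of packing `< η₁` on `[0, t₁)`, whose
data agree OFF the closed chart ball `{x₀ + proj y : ‖y‖ ≤ R₀}`, agree at every `(t, x)`, `t < t₁`, with `x` off the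
fattened ball `{x₀ + proj y : ‖y‖ ≤ R₀ + c t}` — where `c` bounds `‖u₁‖ + √(2 θ₁)` (a bound of the characteristic speed
at packing `< η₁`) of the FIRST solution only; NO a-priori hypothesis on the second (continuity induction in time over cone
locality in charts around exterior points; `R₀ + c t₁ < 1/4` keeps every cone inside one chart). -/
def ExteriorAgreement : Prop :=
  ∃ η₁ : ℝ, 0 < η₁ ∧
    ∀ (σ T₁ T₂ t₁ : ℝ) (ρ₁ θ₁ ρ₂ θ₂ : ℝ → T3 → ℝ) (u₁ u₂ : ℝ → T3 → V3) (x₀ : T3) (R₀ c : ℝ),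
      0 < σ → IsHardSphereEulerSolution σ T₁ ρ₁ u₁ θ₁ → IsHardSphereEulerSolution σ T₂ ρ₂ u₂ θ₂ →
      t₁ ≤ T₁ → t₁ ≤ T₂ → 0 ≤ R₀ → 0 ≤ c → R₀ + c * t₁ < 1 / 4 →
      (∀ t ∈ Set.Ico 0 t₁, ∀ x, ρ₁ t x * σ ^ 3 < η₁ ∧ ρ₂ t x * σ ^ 3 < η₁) →
      (∀ t ∈ Set.Ico 0 t₁, ∀ x, ‖u₁ t x‖ + Real.sqrt (2 * θ₁ t x) ≤ c) →
      (∀ x : T3, (¬ ∃ y : V3, ‖y‖ ≤ R₀ ∧ x = x₀ + Torus.proj y) →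
        ρ₁ 0 x = ρ₂ 0 x ∧ u₁ 0 x = u₂ 0 x ∧ θ₁ 0 x = θ₂ 0 x) →
      ∀ t ∈ Set.Ico 0 t₁, ∀ x : T3, (¬ ∃ y : V3, ‖y‖ ≤ R₀ + c * t ∧ x = x₀ + Torus.proj y) →
        ρ₁ t x = ρ₂ t x ∧ u₁ t x = u₂ t x ∧ θ₁ t x = θ₂ t x

namespace ExteriorAgreementProof

/-! ## A classical solution with pressure `ρθζ(ρ)`, read in a chart, solves `AthermalEulerAt ζ` -/

section ChartLaw

variable {σ T : ℝ} {ρ θ : ℝ → T3 → ℝ} {u : ℝ → T3 → V3} {ζ : ℝ → ℝ} {J : Set ℝ}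

/-- **Chart reading with a general athermal law** (the `σ > 0` twin of `MemberCoreProof.athermalEulerAt_chart`):
a classical hard-sphere–Euler solution on `[0, T)` whose pressure field is `ρθζ(ρ)` for a `ζ` smooth on an open
`J` containing the values of the density, read in the chart `v ↦ x₀ + proj v`, satisfies `AthermalEulerAt ζ` at every
interior time `0 < t < T` and every `y ∈ ℝ³` (primitive form of the conservative system,
`IsHardSphereEulerSolution.timeDeriv_density_eq` & co.; torus operators read in the chart). [folklore] -/
theorem athermalEulerAt_chart_law (hE : IsHardSphereEulerSolution σ T ρ u θ) (hJ : IsOpen J)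
    (hζ : ContDiffOn ℝ ∞ ζ J) (hρJ : ∀ t ∈ Ico 0 T, ∀ x, ρ t x ∈ J)
    (hp : ∀ t ∈ Ico 0 T, ∀ x, hsPressure σ (ρ t x) (θ t x) = ρ t x * θ t x * ζ (ρ t x))
    (x₀ : T3) {t : ℝ} (ht : t ∈ Ioo 0 T) (y : V3) :
    AthermalEulerAt ζ (fun s v => ρ s (x₀ + Torus.proj v)) (fun s v => θ s (x₀ + Torus.proj v))
      (fun s v => u s (x₀ + Torus.proj v)) t y := by
  have ht' : t ∈ Ico 0 T := Ioo_subset_Ico_self ht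
  have hti : t ∈ interior (Ico 0 T) := by rwa [interior_Ico]
  have hnhd : Ico 0 T ∈ 𝓝 t := mem_interior_iff_mem_nhds.1 hti
  -- the primitive equations at `(t, x₀ + proj y)`
  have h1 := hE.timeDeriv_density_eq ht' (x₀ + Torus.proj y)
  have h2 := fun j => hE.density_mul_timeDeriv_velocity_eq hJ hζ hρJ hp ht' (x₀ + Torus.proj y) j
  have h3 := hE.timeDeriv_temperature_eq hJ hζ hρJ hp ht' (x₀ + Torus.proj y)
  -- regularity of the slices
  have hρ1 : Torus.IsContDiff 1 (ρ t) := (hE.smooth_density.isSmooth_slice ht').isContDiff (by simp)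
  have hθ1 : Torus.IsContDiff 1 (θ t) := (hE.smooth_temperature.isSmooth_slice ht').isContDiff (by simp)
  have hu1 : Torus.IsContDiff 1 (u t) := (hE.smooth_velocity.isSmooth_slice ht').isContDiff (by simp)
  have huj1 : ∀ j, Torus.IsContDiff 1 (fun z => u t z j) := fun j => HsEulerCalc.isContDiff_apply_coord hu1 j
  have hUs : DifferentiableAt ℝ (fun v => u t (x₀ + Torus.proj v)) y :=
    (((hE.smooth_velocity.isSmooth_slice ht').liftAt x₀).differentiable (by simp)).differentiableAt
  have hUt : DifferentiableAt ℝ (fun s => u s (x₀ + Torus.proj y)) t :=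
    (hE.smooth_velocity.hasDerivWithinAt_slice ht' (x₀ + Torus.proj y)).differentiableWithinAt.differentiableAt
      hnhd
  -- torus operators in the chart
  have cTρ : Torus.timeDerivWithin (Ico 0 T) ρ t (x₀ + Torus.proj y) =
      deriv (fun s => ρ s (x₀ + Torus.proj y)) t :=
    Torus.timeDerivWithin_of_mem_interior hti _
  have cTθ : Torus.timeDerivWithin (Ico 0 T) θ t (x₀ + Torus.proj y) =
      deriv (fun s => θ s (x₀ + Torus.proj y)) t :=
    Torus.timeDerivWithin_of_mem_interior hti _
  have cTu : ∀ j, Torus.timeDerivWithin (Ico 0 T) (fun s z => u s z j) t (x₀ + Torus.proj y) =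
      deriv (fun s => u s (x₀ + Torus.proj y)) t j := fun j => by
    rw [Torus.timeDerivWithin_of_mem_interior hti, deriv_apply_coord hUt]
    rfl
  have cXρ : ∀ i, Torus.partialDeriv i (ρ t) (x₀ + Torus.proj y) =
      fderiv ℝ (fun v => ρ t (x₀ + Torus.proj v)) y (EuclideanSpace.single i 1) :=
    fun i => torusPartialDeriv_chart hρ1 i x₀ y
  have cXθ : ∀ i, Torus.partialDeriv i (θ t) (x₀ + Torus.proj y) =
      fderiv ℝ (fun v => θ t (x₀ + Torus.proj v)) y (EuclideanSpace.single i 1) :=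
    fun i => torusPartialDeriv_chart hθ1 i x₀ y
  have cXu : ∀ i j, Torus.partialDeriv i (fun z => u t z j) (x₀ + Torus.proj y) =
      fderiv ℝ (fun v => u t (x₀ + Torus.proj v) j) y (EuclideanSpace.single i 1) :=
    fun i j => torusPartialDeriv_chart (huj1 j) i x₀ y
  simp only [cTρ, cXρ, cXu] at h1
  simp only [cTu, cXρ, cXθ, cXu] at h2
  simp only [cTθ, cXθ, cXu] at h3
  unfold AthermalEulerAt
  dsimp only
  refine ⟨?_, ?_, ?_⟩
  · rw [h1, IsentropicEuler.clm_apply_eq_sum (fderiv ℝ (fun v => ρ t (x₀ + Torus.proj v)) y)]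
    simp only [smul_eq_mul, fderiv_apply_coord hUs, Finset.mul_sum, ← Finset.sum_add_distrib,
      ← Finset.sum_neg_distrib]
    refine Finset.sum_eq_zero fun i _ => ?_
    ring
  · ext j
    simp only [PiLp.add_apply, PiLp.smul_apply, PiLp.zero_apply, smul_eq_mul, gradient_apply_eq_fderiv,
      fderiv_apply_coord hUs]
    rw [IsentropicEuler.clm_apply_eq_sum (fderiv ℝ (fun v => u t (x₀ + Torus.proj v) j) y)]
    simp only [smul_eq_mul]
    linear_combination h2 j
  · rw [h3, IsentropicEuler.clm_apply_eq_sum (fderiv ℝ (fun v => θ t (x₀ + Torus.proj v)) y)]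
    simp only [smul_eq_mul, fderiv_apply_coord hUs]
    ring

end ChartLaw

/-! ## Extrema on compact time slabs and the margin of an exterior point -/

/-- **Extrema on a compact time slab.** A jointly smooth real field on `S × 𝕋³` attains its minimum and its maximum
on `K × 𝕋³` for every nonempty compact `K ⊆ S` (the torus is the image of the compact unit cube of `ℝ³`).
[folklore] -/
theorem exists_forall_le_and_forall_ge {S K : Set ℝ} {f : ℝ → T3 → ℝ} (hf : Torus.IsSmoothSpaceTimeOn S f)
    (hK : IsCompact K) (hKS : K ⊆ S) (hne : K.Nonempty) :
    (∃ s₀ ∈ K, ∃ x₀ : T3, ∀ s ∈ K, ∀ x, f s₀ x₀ ≤ f s x) ∧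
      ∃ s₀ ∈ K, ∃ x₀ : T3, ∀ s ∈ K, ∀ x, f s x ≤ f s₀ x₀ := by
  set C : Set (ℝ × V3) := K ×ˢ ((WithLp.toLp 2) '' (Set.pi univ fun _ : Fin 3 => Icc (0 : ℝ) 1)) with hC
  have hCc : IsCompact C := hK.prod Torus.isCompact_toLp_image_pi_Icc
  have hmemC : ∀ s ∈ K, ∀ x : T3, (s, Torus.repr x) ∈ C := fun s hs x =>
    mk_mem_prod hs (Torus.repr_mem_toLp_image_pi_Icc x)
  obtain ⟨s', hs'⟩ := hne
  have hCne : C.Nonempty := ⟨_, hmemC s' hs' 0⟩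
  have hcont : ContinuousOn (Torus.stLift f) C := hf.continuousOn_stLift.mono (prod_mono hKS (subset_univ _))
  have hval : ∀ (s : ℝ) (x : T3), Torus.stLift f (s, Torus.repr x) = f s x := fun s x => by
    rw [Torus.stLift_apply, Torus.proj_repr]
  constructor
  · obtain ⟨⟨s₀, y₀⟩, hp, hmin⟩ := hCc.exists_isMinOn hCne hcont
    refine ⟨s₀, (mem_prod.1 hp).1, Torus.proj y₀, fun s hs x => ?_⟩
    simpa only [hval, Torus.stLift_apply] using isMinOn_iff.1 hmin _ (hmemC s hs x)
  · obtain ⟨⟨s₀, y₀⟩, hp, hmax⟩ := hCc.exists_isMaxOn hCne hcont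
    refine ⟨s₀, (mem_prod.1 hp).1, Torus.proj y₀, fun s hs x => ?_⟩
    simpa only [hval, Torus.stLift_apply] using isMaxOn_iff.1 hmax _ (hmemC s hs x)

/-- **Margin of a point off a closed chart ball.** If `x ∈ 𝕋³` is not of the form `x₀ + proj y` with `‖y‖ ≤ r`, then
there is `m > r` below the norms of ALL chart preimages of `x` (the preimages form a closed set; minimise the norm on
its compact trace in the closed ball of radius `r + 1`). [folklore] -/
theorem exists_margin {x₀ x : T3} {r : ℝ} (h : ¬ ∃ y : V3, ‖y‖ ≤ r ∧ x = x₀ + Torus.proj y) :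
    ∃ m : ℝ, r < m ∧ ∀ z : V3, x = x₀ + Torus.proj z → m ≤ ‖z‖ := by
  have hgt : ∀ z : V3, x = x₀ + Torus.proj z → r < ‖z‖ := fun z hz =>
    lt_of_not_ge fun hle => h ⟨z, hle, hz⟩
  set A : Set V3 := Metric.closedBall (0 : V3) (r + 1) ∩ {z : V3 | x = x₀ + Torus.proj z} with hA
  have hAc : IsCompact A :=
    (isCompact_closedBall (0 : V3) (r + 1)).inter_right
      (isClosed_eq continuous_const (continuous_const.add Torus.continuous_proj))
  by_cases hne : A.Nonempty
  · obtain ⟨z₀, hz₀, hmin⟩ := hAc.exists_isMinOn hne continuous_norm.continuousOn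
    refine ⟨min ‖z₀‖ (r + 1), lt_min (hgt z₀ hz₀.2) (lt_add_one r), fun z hz => ?_⟩
    by_cases hzr : ‖z‖ ≤ r + 1
    · exact (min_le_left _ _).trans (isMinOn_iff.1 hmin z ⟨mem_closedBall_zero_iff.2 hzr, hz⟩)
    · exact (min_le_right _ _).trans (not_le.1 hzr).le
  · refine ⟨r + 1, lt_add_one r, fun z hz => ?_⟩
    by_contra hzr
    exact hne ⟨z, mem_closedBall_zero_iff.2 (not_le.1 hzr).le, hz⟩

/-! ## Agreement off the fattened ball for a general smooth law -/

/-- **Exterior agreement for a smooth athermal law.** Let `ζ ∈ C^∞(ℝ)` be hyperbolic (`ζ + rζ′ > 0`) with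
`ζ + rζ′ + (2/3)ζ² ≤ 2` on the density range `(0, ρ̄)`. Two classical hard-sphere–Euler solutions on `𝕋³` whose pressure
fields are `ρθζ(ρ)` and whose densities stay `< ρ̄` on `[0, t₁)`, with `‖u₁‖ + √(2θ₁) ≤ c` there and equal data off the
closed chart ball `{x₀ + proj y : ‖y‖ ≤ R₀}`, agree at every `(t, x)`, `0 ≤ t < t₁`, `x` off the fattened ball
`{x₀ + proj y : ‖y‖ ≤ R₀ + ct}`: restrict to a horizon `τ ∈ (t, t₁)`, bound the densities on the compact slab
`[0, τ] × 𝕋³`, read both solutions in the chart at `x₀` and apply the straight-cone locality `stub_coneLocality` on the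
cone with vertex a preimage `z` of `x` and radius `ct + ε`, `ε` half the margin of `exists_margin`. [folklore] -/
theorem agree_of_law {ζ : ℝ → ℝ} {ρbar : ℝ} (hζ : ContDiff ℝ ∞ ζ)
    (hhyp : ∀ r ∈ Ioo 0 ρbar, 0 < ζ r + r * deriv ζ r)
    (hcs : ∀ r ∈ Ioo 0 ρbar, ζ r + r * deriv ζ r + 2 / 3 * ζ r ^ 2 ≤ 2)
    {σ T₁ T₂ t₁ : ℝ} {ρ₁ θ₁ ρ₂ θ₂ : ℝ → T3 → ℝ} {u₁ u₂ : ℝ → T3 → V3} {x₀ : T3} {R₀ c : ℝ}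
    (hE₁ : IsHardSphereEulerSolution σ T₁ ρ₁ u₁ θ₁) (hE₂ : IsHardSphereEulerSolution σ T₂ ρ₂ u₂ θ₂)
    (ht₁ : t₁ ≤ T₁) (ht₂ : t₁ ≤ T₂) (hc : 0 ≤ c)
    (hp₁ : ∀ s ∈ Ico 0 t₁, ∀ z, hsPressure σ (ρ₁ s z) (θ₁ s z) = ρ₁ s z * θ₁ s z * ζ (ρ₁ s z))
    (hp₂ : ∀ s ∈ Ico 0 t₁, ∀ z, hsPressure σ (ρ₂ s z) (θ₂ s z) = ρ₂ s z * θ₂ s z * ζ (ρ₂ s z))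
    (hlt : ∀ s ∈ Ico 0 t₁, ∀ z, ρ₁ s z < ρbar ∧ ρ₂ s z < ρbar)
    (hspeed : ∀ s ∈ Ico 0 t₁, ∀ z, ‖u₁ s z‖ + Real.sqrt (2 * θ₁ s z) ≤ c)
    (hdata : ∀ x : T3, (¬ ∃ y : V3, ‖y‖ ≤ R₀ ∧ x = x₀ + Torus.proj y) →
      ρ₁ 0 x = ρ₂ 0 x ∧ u₁ 0 x = u₂ 0 x ∧ θ₁ 0 x = θ₂ 0 x)
    {t : ℝ} (ht : t ∈ Ico 0 t₁) {x : T3} (hx : ¬ ∃ y : V3, ‖y‖ ≤ R₀ + c * t ∧ x = x₀ + Torus.proj y) :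
    ρ₁ t x = ρ₂ t x ∧ u₁ t x = u₂ t x ∧ θ₁ t x = θ₂ t x := by
  -- a horizon `τ ∈ (t, t₁)`; both solutions restricted to `[0, τ)`
  obtain ⟨τ, htτ, hτt₁⟩ := exists_between ht.2
  have hsub : Ico (0 : ℝ) τ ⊆ Ico 0 t₁ := Ico_subset_Ico_right hτt₁.le
  have hE₁' : IsHardSphereEulerSolution σ τ ρ₁ u₁ θ₁ :=
    isHardSphereEulerSolution_restrict hE₁ (hτt₁.le.trans ht₁)
  have hE₂' : IsHardSphereEulerSolution σ τ ρ₂ u₂ θ₂ :=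
    isHardSphereEulerSolution_restrict hE₂ (hτt₁.le.trans ht₂)
  have hJ : ∀ (f : ℝ → T3 → ℝ), ∀ s ∈ Ico (0 : ℝ) τ, ∀ w : T3, f s w ∈ (univ : Set ℝ) :=
    fun _ _ _ _ => mem_univ _
  -- extrema of the densities on the compact slab `[0, τ] × 𝕋³`
  have hK₁ : Icc (0 : ℝ) τ ⊆ Ico 0 T₁ := fun s hs => ⟨hs.1, hs.2.trans_lt (hτt₁.trans_le ht₁)⟩
  have hK₂ : Icc (0 : ℝ) τ ⊆ Ico 0 T₂ := fun s hs => ⟨hs.1, hs.2.trans_lt (hτt₁.trans_le ht₂)⟩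
  have hKt : Icc (0 : ℝ) τ ⊆ Ico 0 t₁ := fun s hs => ⟨hs.1, hs.2.trans_lt hτt₁⟩
  have hne : (Icc (0 : ℝ) τ).Nonempty := nonempty_Icc.2 (ht.1.trans htτ.le)
  obtain ⟨⟨s₁, hs₁, x₁, hmin₁⟩, s₁', hs₁', x₁', hmax₁⟩ :=
    exists_forall_le_and_forall_ge hE₁.smooth_density isCompact_Icc hK₁ hne
  obtain ⟨⟨s₂, hs₂, x₂, hmin₂⟩, s₂', hs₂', x₂', hmax₂⟩ :=
    exists_forall_le_and_forall_ge hE₂.smooth_density isCompact_Icc hK₂ hne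
  have ha : 0 < min (ρ₁ s₁ x₁) (ρ₂ s₂ x₂) :=
    lt_min (hE₁.density_pos s₁ (hK₁ hs₁) x₁) (hE₂.density_pos s₂ (hK₂ hs₂) x₂)
  have hb : max (ρ₁ s₁' x₁') (ρ₂ s₂' x₂') < ρbar :=
    max_lt (hlt s₁' (hKt hs₁') x₁').1 (hlt s₂' (hKt hs₂') x₂').2
  have hab : Icc (min (ρ₁ s₁ x₁) (ρ₂ s₂ x₂)) (max (ρ₁ s₁' x₁') (ρ₂ s₂' x₂')) ⊆ Ioo 0 ρbar :=
    fun r hr => ⟨ha.trans_le hr.1, hr.2.trans_lt hb⟩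
  -- the margin of `x` off the fattened ball, and a chart preimage `z` of `x`
  obtain ⟨m, hm, hmz⟩ := exists_margin hx
  obtain ⟨z, rfl⟩ : ∃ z : V3, x = x₀ + Torus.proj z := by
    obtain ⟨w, hw⟩ := Torus.proj_surjective (x - x₀)
    exact ⟨w, by rw [hw, add_sub_cancel]⟩
  obtain ⟨ε, hε, hmε⟩ : ∃ ε : ℝ, 0 < ε ∧ R₀ + c * t + 2 * ε ≤ m :=
    ⟨(m - (R₀ + c * t)) / 2, by linarith, by linarith⟩
  -- straight-cone locality in the chart at `x₀`: vertex `z`, radius `c t + ε`, horizon `τ`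
  refine stub_coneLocality.eq_of_cone (ζ := ζ) (x₀ := z) (R := c * t + ε) (c := c) (t₁ := τ)
    (P₁ := fun s v => ρ₁ s (x₀ + Torus.proj v)) (Θ₁ := fun s v => θ₁ s (x₀ + Torus.proj v))
    (P₂ := fun s v => ρ₂ s (x₀ + Torus.proj v)) (Θ₂ := fun s v => θ₂ s (x₀ + Torus.proj v))
    (U₁ := fun s v => u₁ s (x₀ + Torus.proj v)) (U₂ := fun s v => u₂ s (x₀ + Torus.proj v))
    isOpen_univ hζ.contDiffOn (subset_univ _) ha (fun r hr => hhyp r (hab hr))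
    ((contDiffOn_chart hE₁'.smooth_density x₀).of_le (by simp))
    ((contDiffOn_chart hE₁'.smooth_temperature x₀).of_le (by simp))
    ((contDiffOn_chart hE₁'.smooth_velocity x₀).of_le (by simp))
    ((contDiffOn_chart hE₂'.smooth_density x₀).of_le (by simp))
    ((contDiffOn_chart hE₂'.smooth_temperature x₀).of_le (by simp))
    ((contDiffOn_chart hE₂'.smooth_velocity x₀).of_le (by simp))
    ?_ ?_ hc ?_ ?_ (t := t) ⟨ht.1, htτ⟩ (x := z)
    (by rw [sub_self, norm_zero, zero_add]; exact lt_add_of_pos_right _ hε)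
  · -- densities in `[a, b]`, temperatures positive, on the whole slab
    intro s hs v _
    have hsK : s ∈ Icc (0 : ℝ) τ := Ico_subset_Icc_self hs
    exact ⟨⟨(min_le_left _ _).trans (hmin₁ s hsK _), (hmax₁ s hsK _).trans (le_max_left _ _)⟩,
      ⟨(min_le_right _ _).trans (hmin₂ s hsK _), (hmax₂ s hsK _).trans (le_max_right _ _)⟩,
      hE₁'.temperature_pos s hs _, hE₂'.temperature_pos s hs _⟩
  · -- both chart-read triples solve `AthermalEulerAt ζ` at interior times
    intro s hs v _
    exact ⟨athermalEulerAt_chart_law hE₁' isOpen_univ hζ.contDiffOn (hJ ρ₁) (fun s hs w => hp₁ s (hsub hs) w)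
        x₀ hs v,
      athermalEulerAt_chart_law hE₂' isOpen_univ hζ.contDiffOn (hJ ρ₂) (fun s hs w => hp₂ s (hsub hs) w)
        x₀ hs v⟩
  · -- `c` dominates the characteristic speed of the first solution
    intro s hs v _
    have hs' : s ∈ Ico 0 t₁ := hsub (Ioo_subset_Ico_self hs)
    have hsT : s ∈ Ico 0 T₁ := ⟨hs'.1, hs'.2.trans_le ht₁⟩
    have hθp : 0 < θ₁ s (x₀ + Torus.proj v) := hE₁.temperature_pos s hsT _
    have hζs := hcs _ ⟨hE₁.density_pos s hsT (x₀ + Torus.proj v), (hlt s hs' _).1⟩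
    refine le_trans (add_le_add le_rfl (Real.sqrt_le_sqrt ?_)) (hspeed s hs' _)
    nlinarith [hζs, hθp]
  · -- equal data on the base ball `‖v - z‖ < c t + ε`
    intro v hv
    refine hdata (x₀ + Torus.proj v) ?_
    rintro ⟨y, hy, hyv⟩
    have h1 : Torus.proj v = Torus.proj y := add_left_cancel hyv
    have hpre : x₀ + Torus.proj z = x₀ + Torus.proj (z + (y - v)) := by
      rw [show Torus.proj (z + (y - v)) = Torus.proj z + (Torus.proj y - Torus.proj v) from rfl, h1, sub_self,
        add_zero]
    have h2 := hmz _ hpre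
    have h3 : ‖z + (y - v)‖ ≤ ‖y‖ + ‖v - z‖ := by
      calc ‖z + (y - v)‖ = ‖y - (v - z)‖ := by congr 1; abel
        _ ≤ ‖y‖ + ‖v - z‖ := norm_sub_le _ _
    linarith

end ExteriorAgreementProof

open ExteriorAgreementProof

/-! ## The packing threshold and the stub -/

/-- **Packing threshold.** For a smooth `Z` agreeing with `hsCompressibility` on `[0, η₀]`, `η₀ > 0`, there is
`η₁ ∈ (0, η₀]` with `Z(η) + ηZ′(η) > 0` (hyperbolicity) and `Z(η) + ηZ′(η) + (2/3)Z(η)² ≤ 2` (athermal sound speed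
`≤ √(2θ)`) for all `η ∈ [0, η₁]`: continuity at `η = 0`, where the two quantities are `1` and `5/3` (`Z(0) = 1`,
`hsCompressibility_zero`). [folklore] -/
theorem exists_packing_threshold {Z : ℝ → ℝ} {η₀ : ℝ} (hη₀ : 0 < η₀) (hZ : ContDiff ℝ ∞ Z)
    (hEq : EqOn hsCompressibility Z (Icc 0 η₀)) :
    ∃ η₁ : ℝ, 0 < η₁ ∧ η₁ ≤ η₀ ∧ ∀ η ∈ Icc 0 η₁,
      0 < Z η + η * deriv Z η ∧ Z η + η * deriv Z η + 2 / 3 * Z η ^ 2 ≤ 2 := by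
  have hc1 : Continuous fun η => Z η + η * deriv Z η :=
    hZ.continuous.add (continuous_id.mul (hZ.continuous_deriv (by simp)))
  have hc2 : Continuous fun η => Z η + η * deriv Z η + 2 / 3 * Z η ^ 2 :=
    hc1.add (continuous_const.mul (hZ.continuous.pow 2))
  have hZ0 : Z 0 = 1 := by rw [← hEq ⟨le_rfl, hη₀.le⟩, hsCompressibility_zero]
  have hopen : IsOpen {η : ℝ | 0 < Z η + η * deriv Z η ∧ Z η + η * deriv Z η + 2 / 3 * Z η ^ 2 < 2} :=
    (isOpen_lt continuous_const hc1).inter (isOpen_lt hc2 continuous_const)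
  have hmem : (0 : ℝ) ∈ {η : ℝ | 0 < Z η + η * deriv Z η ∧ Z η + η * deriv Z η + 2 / 3 * Z η ^ 2 < 2} := by
    simp only [mem_setOf_eq, hZ0, zero_mul, add_zero]
    norm_num
  obtain ⟨δ, hδ, hball⟩ := Metric.isOpen_iff.1 hopen 0 hmem
  refine ⟨min η₀ (δ / 2), lt_min hη₀ (half_pos hδ), min_le_left _ _, fun η hη => ?_⟩
  have hηδ : η ∈ Metric.ball (0 : ℝ) δ := by
    rw [Metric.mem_ball, Real.dist_eq, sub_zero, abs_of_nonneg hη.1]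
    exact lt_of_le_of_lt (hη.2.trans (min_le_right _ _)) (half_lt_self hδ)
  exact ⟨(hball hηδ).1, (hball hηδ).2.le⟩

/-- **STUB `stub_exteriorAgreement`** (line `r2-one-mode-two-conditions`, v8): EXTERIOR AGREEMENT on the torus. With
`η₀, Z` from `exists_smooth_compressibility_Icc hsEosLowDensity_proof` and `η₁` from `exists_packing_threshold`, two
classical hard-sphere solutions of packing `< η₁` have pressure `ρθζ(ρ)` for the smooth rescaled law `ζ(r) = Z(rσ³)`,
hyperbolic with `ζ + rζ′ + (2/3)ζ² ≤ 2` on the density range `(0, η₁σ⁻³)`; `agree_of_law` (chart reading + margin +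
the landed straight-cone locality `stub_coneLocality`) concludes. [folklore] -/
theorem stub_exteriorAgreement : ExteriorAgreement := by
  obtain ⟨η₀, hη₀, Z, hZ, hEq⟩ := exists_smooth_compressibility_Icc hsEosLowDensity_proof
  obtain ⟨η₁, hη₁, hη₁₀, hgood⟩ := exists_packing_threshold hη₀ hZ hEq
  refine ⟨η₁, hη₁, ?_⟩
  intro σ T₁ T₂ t₁ ρ₁ θ₁ ρ₂ θ₂ u₁ u₂ x₀ R₀ c hσ hE₁ hE₂ ht₁ ht₂ _ hc _ hpack hspeed hdata t ht x hx
  have hσ3 : 0 < σ ^ 3 := pow_pos hσ 3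
  -- the rescaled law `ζ(r) = Z(rσ³)`: smooth, `ζ + rζ′ = Z + ηZ′` at `η = rσ³`
  have hζ : ContDiff ℝ ∞ (fun r => Z (r * σ ^ 3)) := hZ.comp (contDiff_id.mul contDiff_const)
  have hγ : ∀ r, Z (r * σ ^ 3) + r * deriv (fun r => Z (r * σ ^ 3)) r =
      Z (r * σ ^ 3) + r * σ ^ 3 * deriv Z (r * σ ^ 3) := fun r => by
    have hd : HasDerivAt (fun r => Z (r * σ ^ 3)) (deriv Z (r * σ ^ 3) * σ ^ 3) r :=
      ((hZ.differentiable (by simp)) (r * σ ^ 3)).hasDerivAt.comp r (hasDerivAt_mul_const (σ ^ 3))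
    rw [hd.deriv]
    ring
  have hrange : ∀ r ∈ Ioo 0 (η₁ / σ ^ 3), r * σ ^ 3 ∈ Icc 0 η₁ := fun r hr =>
    ⟨(mul_pos hr.1 hσ3).le, ((lt_div_iff₀ hσ3).1 hr.2).le⟩
  have hhyp : ∀ r ∈ Ioo 0 (η₁ / σ ^ 3), 0 < Z (r * σ ^ 3) + r * deriv (fun r => Z (r * σ ^ 3)) r :=
    fun r hr => by rw [hγ]; exact (hgood _ (hrange r hr)).1
  have hcs : ∀ r ∈ Ioo 0 (η₁ / σ ^ 3),
      Z (r * σ ^ 3) + r * deriv (fun r => Z (r * σ ^ 3)) r + 2 / 3 * Z (r * σ ^ 3) ^ 2 ≤ 2 :=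
    fun r hr => by rw [hγ]; exact (hgood _ (hrange r hr)).2
  -- pressure law `p = ρθζ(ρ)` at packing `< η₁ ≤ η₀`
  have hp : ∀ {T : ℝ} {ρ θ : ℝ → T3 → ℝ} {u : ℝ → T3 → V3}, IsHardSphereEulerSolution σ T ρ u θ → t₁ ≤ T →
      (∀ s ∈ Ico 0 t₁, ∀ w, ρ s w * σ ^ 3 < η₁) → ∀ s ∈ Ico 0 t₁, ∀ w,
        hsPressure σ (ρ s w) (θ s w) = ρ s w * θ s w * Z (ρ s w * σ ^ 3) := by
    intro T ρ θ u hE hT hpk s hs w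
    have h0 : 0 ≤ ρ s w * σ ^ 3 := (mul_pos (hE.density_pos s ⟨hs.1, hs.2.trans_le hT⟩ w) hσ3).le
    rw [hsPressure, hEq ⟨h0, (hpk s hs w).le.trans hη₁₀⟩]
  exact agree_of_law (ζ := fun r => Z (r * σ ^ 3)) (ρbar := η₁ / σ ^ 3) hζ hhyp hcs hE₁ hE₂ ht₁ ht₂ hc
    (hp hE₁ ht₁ fun s hs w => (hpack s hs w).1) (hp hE₂ ht₂ fun s hs w => (hpack s hs w).2)
    (fun s hs w => ⟨(lt_div_iff₀ hσ3).2 (hpack s hs w).1, (lt_div_iff₀ hσ3).2 (hpack s hs w).2⟩)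
    hspeed hdata ht hx

end Summit.AtomisticToContinuum.HydrodynamicLimit.Theorems.R2OneModeTwoConditions

end
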